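import Summits.ABC.IUTFork.Conditional.AbcOfJointLicenceGenuineK
import Summits.ABC.IUTFork.Conditional.AbcOfSOrNumKContent
import HarnessLib

/-!
# Branch C, K line — θ-CUT of the JOINT (U)+(P) certificate (`AbcOfJointLicenceGenuineK.lean`, p464071): the single hypothesis demanded only on the
# CONTENT LOCUS of [IUTchIV] Thm. 1.10's display; explicit 1 · CONE 0 · READ 0 · PIN 0 · SIDE 0

C scoreboard (abc-iut-C-cert-2 gen 3). PROOF-ONLY. `abc_of_jointLicence_K_content` = `abc_of_jointLicence_K_szpiroBad` with the Szpiro-bad antecedent of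
`hNumJoint` replaced by abc-iut-C-cert-1's content guard «6(1 + 20·d_mod/l)(log-diff + log-cond) + 120·d*_mod·l < log q^{∤{2,l}}(λ)» (content ⟹
Szpiro-bad for l ≥ 5, `szpiroBad_of_content`, so the binder is WEAKER-OR-EQUAL, C-R2); tail `ABC_of_squeezeIII_content` (p459802: off the locus the
display holds by print's own additive constant, nothing is consumed); the per-`(P,l)` body is p464071's `key` VERBATIM (slot licence ⇒ per-image theorem
with abc-iut-s2-p7's READ-P; union licence ∧ off-mixing ⇒ the (U) theorem route; else `hNumJointC`). HONEST STRENGTH: the binder lives only where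
log q^{∤2l} > 120·d*_mod·l ≥ 4.6·10⁸ nats — no datum is known there; neither instantiated nor refuted; a cut discharges nothing. Nothing here asserts
that abc is proved or refuted or takes a side on [IUTchIII] Cor. 3.12 / [IUTchIV] Thm. 1.10, on (U)/(P), or on any author; typed ≠ proved.
[claim: Mochizuki2012, status: disputed] [cite: Mochizuki2012, IUTchIII Cor. 3.12 p. 174; IUTchIV Thm. 1.10 p. 22–31, Cor. 2.2 (ii) p. 46] [cite: DupuyHilado2025, §1 (1.1), §4.11–4.12]
-/

noncomputable section

open Set Function NumberField IsDedekindDomain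

namespace Summit.ABC.IUTFork.Conditional

open Thm311 Thm311.Real Cor312 Cor312Vol Cor312Prov Literature.IUT.LogThetaLattice Literature.IUT.LogVolume
  Literature.IUT.HodgeTheaters Literature.IUT.LogVolume.ThetaData Literature.NumberTheory.NumberFields
open Literature.NumberTheory.DiophantineGeometry.GenEll Summit.ABC.ABC.Theorems
open scoped Classical

/-- **`abc_of_jointLicence_K_content`** — the θ-CUT of `abc_of_jointLicence_K_szpiroBad` (abc-iut-C-cert-1's content guard, C-R47/C-R49): the single
hypothesis `hNumJointC` is `hNumJoint` demanded ONLY ON THE CONTENT LOCUS of [IUTchIV] Thm. 1.10's display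
(`6(1 + 20 d_mod/l)(log-diff + log-cond) + 120·d*_mod·l < log q^{∤{2,l}}`; content ⟹ Szpiro-bad, `szpiroBad_of_content`); off the locus nothing is
consumed (`ABC_of_squeezeIII_content`, p459802). explicit 1 · CONE 0 · READ 0 · PIN 0 · SIDE 0. «`ABC` follows from this hypothesis as typed» — no side
taken; typed ≠ proved. [claim: Mochizuki2012, status: disputed] [cite: Mochizuki2012, IUTchIV Thm. 1.10 p. 22–23, Step (viii) p. 30] -/
theorem abc_of_jointLicence_K_content
    (M : ∀ (P : NFPoint) (l : ℕ) (T : Cor22.ThetaVolumeDatumAt P l), Type) [∀ P l T, Field (M P l T)] [∀ P l T, NumberField (M P l T)]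
    (archPk : ∀ (P : NFPoint) (l : ℕ) (T : Cor22.ThetaVolumeDatumAt P l), letI := T.instFieldF; letI := T.instNumberFieldF; letI := T.instAlgebraF; letI := T.instFieldK;
        letI := T.instNumberFieldK; letI := T.instAlgebraK; letI := T.instFieldFbar; letI := T.instAlgebraFbar;
        letI := T.instAlgebraKFbar; letI := T.instIsElliptic;
      ∀ (j : (thetaIndex (pilotDataOfK T.D T.K)).Label) (vQ : (thetaIndex (pilotDataOfK T.D T.K)).VQ), Set ((logShellsDH (pilotDataOfK T.D T.K) (analyticLogv T.K)).Packet j vQ))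
    (archSub : ∀ (P : NFPoint) (l : ℕ) (T : Cor22.ThetaVolumeDatumAt P l), letI := T.instFieldF; letI := T.instNumberFieldF; letI := T.instAlgebraF; letI := T.instFieldK;
        letI := T.instNumberFieldK; letI := T.instAlgebraK; letI := T.instFieldFbar; letI := T.instAlgebraFbar;
        letI := T.instAlgebraKFbar; letI := T.instIsElliptic;
      ∀ (j : (thetaIndex (pilotDataOfK T.D T.K)).Label) (v : (thetaIndex (pilotDataOfK T.D T.K)).V), Set ((logShellsDH (pilotDataOfK T.D T.K) (analyticLogv T.K)).Packet j ((thetaIndex (pilotDataOfK T.D T.K)).over v)))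
    (Ψ : ∀ (P : NFPoint) (l : ℕ) (T : Cor22.ThetaVolumeDatumAt P l), letI := T.instFieldF; letI := T.instNumberFieldF; letI := T.instAlgebraF; letI := T.instFieldK;
        letI := T.instNumberFieldK; letI := T.instAlgebraK; letI := T.instFieldFbar; letI := T.instAlgebraFbar;
        letI := T.instAlgebraKFbar; letI := T.instIsElliptic;
      ℤ → ∀ v : (thetaIndex (pilotDataOfK T.D T.K)).V, v ∈ (thetaIndex (pilotDataOfK T.D T.K)).Vbad → Set ((logShellsDH (pilotDataOfK T.D T.K) (analyticLogv T.K)).StarPacket v))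
    (act : ∀ (P : NFPoint) (l : ℕ) (T : Cor22.ThetaVolumeDatumAt P l), letI := T.instFieldF; letI := T.instNumberFieldF; letI := T.instAlgebraF; letI := T.instFieldK;
        letI := T.instNumberFieldK; letI := T.instAlgebraK; letI := T.instFieldFbar; letI := T.instAlgebraFbar;
        letI := T.instAlgebraKFbar; letI := T.instIsElliptic;
      ℤ → ∀ v : (thetaIndex (pilotDataOfK T.D T.K)).V, v ∈ (thetaIndex (pilotDataOfK T.D T.K)).Vbad → (logShellsDH (pilotDataOfK T.D T.K) (analyticLogv T.K)).StarPacket v → Module.End ℚ ((logShellsDH (pilotDataOfK T.D T.K) (analyticLogv T.K)).StarPacket v))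
    (Mmod : ∀ (P : NFPoint) (l : ℕ) (T : Cor22.ThetaVolumeDatumAt P l), letI := T.instFieldF; letI := T.instNumberFieldF; letI := T.instAlgebraF; letI := T.instFieldK;
        letI := T.instNumberFieldK; letI := T.instAlgebraK; letI := T.instFieldFbar; letI := T.instAlgebraFbar;
        letI := T.instAlgebraKFbar; letI := T.instIsElliptic;
      ℤ → ∀ j : (thetaIndex (pilotDataOfK T.D T.K)).LabelStar, Set ((logShellsDH (pilotDataOfK T.D T.K) (analyticLogv T.K)).GlobalPacket j.1))
    (region : ∀ (P : NFPoint) (l : ℕ) (T : Cor22.ThetaVolumeDatumAt P l), letI := T.instFieldF; letI := T.instNumberFieldF; letI := T.instAlgebraF; letI := T.instFieldK;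
        letI := T.instNumberFieldK; letI := T.instAlgebraK; letI := T.instFieldFbar; letI := T.instAlgebraFbar;
        letI := T.instAlgebraKFbar; letI := T.instIsElliptic;
      ℤ → ∀ j : (thetaIndex (pilotDataOfK T.D T.K)).LabelStar, FinDivisor (M P l T) → ∀ vQ : (thetaIndex (pilotDataOfK T.D T.K)).VQ, Set ((logShellsDH (pilotDataOfK T.D T.K) (analyticLogv T.K)).Packet j.1 vQ))
    (frobAdm : ∀ (P : NFPoint) (l : ℕ) (T : Cor22.ThetaVolumeDatumAt P l), letI := T.instFieldF; letI := T.instNumberFieldF; letI := T.instAlgebraF; letI := T.instFieldK;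
        letI := T.instNumberFieldK; letI := T.instAlgebraK; letI := T.instFieldFbar; letI := T.instAlgebraFbar;
        letI := T.instAlgebraKFbar; letI := T.instIsElliptic;
      ℤ → ℤ → ∀ (j : (thetaIndex (pilotDataOfK T.D T.K)).Label) (vQ : (thetaIndex (pilotDataOfK T.D T.K)).VQ), Set ((logShellsDH (pilotDataOfK T.D T.K) (analyticLogv T.K)).Packet j vQ) → Prop)
    (frobLogvol : ∀ (P : NFPoint) (l : ℕ) (T : Cor22.ThetaVolumeDatumAt P l), letI := T.instFieldF; letI := T.instNumberFieldF; letI := T.instAlgebraF; letI := T.instFieldK;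
        letI := T.instNumberFieldK; letI := T.instAlgebraK; letI := T.instFieldFbar; letI := T.instAlgebraFbar;
        letI := T.instAlgebraKFbar; letI := T.instIsElliptic;
      ℤ → ℤ → ∀ (j : (thetaIndex (pilotDataOfK T.D T.K)).Label) (vQ : (thetaIndex (pilotDataOfK T.D T.K)).VQ), Set ((logShellsDH (pilotDataOfK T.D T.K) (analyticLogv T.K)).Packet j vQ) → ℝ)
    (frobΨ : ∀ (P : NFPoint) (l : ℕ) (T : Cor22.ThetaVolumeDatumAt P l), letI := T.instFieldF; letI := T.instNumberFieldF; letI := T.instAlgebraF; letI := T.instFieldK;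
        letI := T.instNumberFieldK; letI := T.instAlgebraK; letI := T.instFieldFbar; letI := T.instAlgebraFbar;
        letI := T.instAlgebraKFbar; letI := T.instIsElliptic;
      ℤ → ℤ → ∀ v : (thetaIndex (pilotDataOfK T.D T.K)).V, v ∈ (thetaIndex (pilotDataOfK T.D T.K)).Vbad → Set ((logShellsDH (pilotDataOfK T.D T.K) (analyticLogv T.K)).StarPacket v))
    (frobMmod : ∀ (P : NFPoint) (l : ℕ) (T : Cor22.ThetaVolumeDatumAt P l), letI := T.instFieldF; letI := T.instNumberFieldF; letI := T.instAlgebraF; letI := T.instFieldK;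
        letI := T.instNumberFieldK; letI := T.instAlgebraK; letI := T.instFieldFbar; letI := T.instAlgebraFbar;
        letI := T.instAlgebraKFbar; letI := T.instIsElliptic;
      ℤ → ℤ → ∀ j : (thetaIndex (pilotDataOfK T.D T.K)).LabelStar, Set ((logShellsDH (pilotDataOfK T.D T.K) (analyticLogv T.K)).GlobalPacket j.1))
    (unitImage : ∀ (P : NFPoint) (l : ℕ) (T : Cor22.ThetaVolumeDatumAt P l), letI := T.instFieldF; letI := T.instNumberFieldF; letI := T.instAlgebraF; letI := T.instFieldK;
        letI := T.instNumberFieldK; letI := T.instAlgebraK; letI := T.instFieldFbar; letI := T.instAlgebraFbar;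
        letI := T.instAlgebraKFbar; letI := T.instIsElliptic;
      ℤ → ℤ → ℕ → ∀ (j : (thetaIndex (pilotDataOfK T.D T.K)).Label) (vQ : (thetaIndex (pilotDataOfK T.D T.K)).VQ), Set ((logShellsDH (pilotDataOfK T.D T.K) (analyticLogv T.K)).Packet j vQ))
    (ballImage : ∀ (P : NFPoint) (l : ℕ) (T : Cor22.ThetaVolumeDatumAt P l), letI := T.instFieldF; letI := T.instNumberFieldF; letI := T.instAlgebraF; letI := T.instFieldK;
        letI := T.instNumberFieldK; letI := T.instAlgebraK; letI := T.instFieldFbar; letI := T.instAlgebraFbar;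
        letI := T.instAlgebraKFbar; letI := T.instIsElliptic;
      ℤ → ℤ → ∀ (j : (thetaIndex (pilotDataOfK T.D T.K)).Label) (vQ : (thetaIndex (pilotDataOfK T.D T.K)).VQ), Set ((logShellsDH (pilotDataOfK T.D T.K) (analyticLogv T.K)).Packet j vQ))
    (thetaDiv : ∀ (P : NFPoint) (l : ℕ) (T : Cor22.ThetaVolumeDatumAt P l), letI := T.instFieldF; letI := T.instNumberFieldF; letI := T.instAlgebraF; letI := T.instFieldK;
        letI := T.instNumberFieldK; letI := T.instAlgebraK; letI := T.instFieldFbar; letI := T.instAlgebraFbar;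
        letI := T.instAlgebraKFbar; letI := T.instIsElliptic;
      ℤ → ℤ → LgpDivisor (M P l T) (thetaIndex (pilotDataOfK T.D T.K)).lstar)
    (n : ∀ (P : NFPoint) (l : ℕ) (T : Cor22.ThetaVolumeDatumAt P l), ℤ)
    {HT : ∀ (P : NFPoint) (l : ℕ) (T : Cor22.ThetaVolumeDatumAt P l), Type} {LogLink : ∀ (P : NFPoint) (l : ℕ) (T : Cor22.ThetaVolumeDatumAt P l), HT P l T → HT P l T → Type}
    {IsFull : ∀ (P : NFPoint) (l : ℕ) (T : Cor22.ThetaVolumeDatumAt P l), ∀ {s t : HT P l T}, LogLink P l T s t → Prop}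
    (lat : ∀ (P : NFPoint) (l : ℕ) (T : Cor22.ThetaVolumeDatumAt P l), LGPGaussianLogThetaLattice (LogLink P l T) (IsFull P l T))
    {Frd : ∀ (P : NFPoint) (l : ℕ) (T : Cor22.ThetaVolumeDatumAt P l), Type} {IsoF : ∀ (P : NFPoint) (l : ℕ) (T : Cor22.ThetaVolumeDatumAt P l), Frd P l T → Frd P l T → Type} {Ob : ∀ (P : NFPoint) (l : ℕ) (T : Cor22.ThetaVolumeDatumAt P l), Frd P l T → Type}
    {realify : ∀ (P : NFPoint) (l : ℕ) (T : Cor22.ThetaVolumeDatumAt P l), Frd P l T → Frd P l T} {Strip : ∀ (P : NFPoint) (l : ℕ) (T : Cor22.ThetaVolumeDatumAt P l), Type} {IsoS : ∀ (P : NFPoint) (l : ℕ) (T : Cor22.ThetaVolumeDatumAt P l), Strip P l T → Strip P l T → Type}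
    {Mv : ∀ (P : NFPoint) (l : ℕ) (T : Cor22.ThetaVolumeDatumAt P l), letI := T.instFieldF; letI := T.instNumberFieldF; letI := T.instAlgebraF; letI := T.instFieldK;
        letI := T.instNumberFieldK; letI := T.instAlgebraK; letI := T.instFieldFbar; letI := T.instAlgebraFbar;
        letI := T.instAlgebraKFbar; letI := T.instIsElliptic;
      ∀ v : (thetaIndex (pilotDataOfK T.D T.K)).V, v ∈ (thetaIndex (pilotDataOfK T.D T.K)).Vbad → Type}
    [∀ P l T v h, Monoid (Mv P l T v h)]
    (sig : ∀ (P : NFPoint) (l : ℕ) (T : Cor22.ThetaVolumeDatumAt P l), letI := T.instFieldF; letI := T.instNumberFieldF; letI := T.instAlgebraF; letI := T.instFieldK;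
        letI := T.instNumberFieldK; letI := T.instAlgebraK; letI := T.instFieldFbar; letI := T.instAlgebraFbar;
        letI := T.instAlgebraKFbar; letI := T.instIsElliptic;
      GlobalLGPFrobenioidSignature (thetaIndex (pilotDataOfK T.D T.K)).lstar (thetaIndex (pilotDataOfK T.D T.K)).V (· ∈ (thetaIndex (pilotDataOfK T.D T.K)).Vbad) (Frd P l T) (IsoF P l T) (Ob P l T) (realify P l T)
        (Strip P l T) (IsoS P l T) (Mv P l T))
    (split : ∀ (P : NFPoint) (l : ℕ) (T : Cor22.ThetaVolumeDatumAt P l), SplittingMonoids (Mv P l T))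
    {ObΔ : ∀ (P : NFPoint) (l : ℕ) (T : Cor22.ThetaVolumeDatumAt P l), Type} {N : ∀ (P : NFPoint) (l : ℕ) (T : Cor22.ThetaVolumeDatumAt P l), letI := T.instFieldF; letI := T.instNumberFieldF; letI := T.instAlgebraF; letI := T.instFieldK;
        letI := T.instNumberFieldK; letI := T.instAlgebraK; letI := T.instFieldFbar; letI := T.instAlgebraFbar;
        letI := T.instAlgebraKFbar; letI := T.instIsElliptic;
      ∀ v : (thetaIndex (pilotDataOfK T.D T.K)).V, v ∈ (thetaIndex (pilotDataOfK T.D T.K)).Vbad → Type}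
    [∀ P l T v h, Monoid (N P l T v h)] (qData : ∀ (P : NFPoint) (l : ℕ) (T : Cor22.ThetaVolumeDatumAt P l), QPilotData (ObΔ P l T) (N P l T))
    (qK : ∀ (P : NFPoint) (l : ℕ) (T : Cor22.ThetaVolumeDatumAt P l), letI := T.instFieldF; letI := T.instNumberFieldF; letI := T.instAlgebraF; letI := T.instFieldK;
        letI := T.instNumberFieldK; letI := T.instAlgebraK; letI := T.instFieldFbar; letI := T.instAlgebraFbar;
        letI := T.instAlgebraKFbar; letI := T.instIsElliptic;
      ∀ v : (thetaIndex (pilotDataOfK T.D T.K)).V, v ∈ (thetaIndex (pilotDataOfK T.D T.K)).Vbad → Set ((logShellsDH (pilotDataOfK T.D T.K) (analyticLogv T.K)).StarPacket v))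
    -- [NUM-JOINT, CONTENT LOCUS] the per-image Corollary ONLY where the slot licence fails AND (the union licence fails OR the point is mixing)
    (hNumJointC : ∀ (P : NFPoint), P ∈ UP → ∀ (l : ℕ), l.Prime → 5 ≤ l →
      Cor22.AdmitsCore P → Cor22.CondP2 P l → Cor22.CondP5 P l → Cor22.CondP6 P l →
      (6 * ((1 + 20 * (Cor22.dmod P : ℝ) / l) * (P.logDiff + Cor22.logCondAvoid P {2, l}))
          + 120 * (2 ^ 12 * 3 ^ 3 * 5 * (Cor22.dmod P : ℝ) * l) < Cor22.logQAvoid P {2, l}) →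
      ∀ (T : Cor22.ThetaVolumeDatumAt P l), letI := T.instFieldF; letI := T.instNumberFieldF; letI := T.instAlgebraF; letI := T.instFieldK;
        letI := T.instNumberFieldK; letI := T.instAlgebraK; letI := T.instFieldFbar; letI := T.instAlgebraFbar;
        letI := T.instAlgebraKFbar; letI := T.instIsElliptic;
      ¬ (settingPrVolSharp (pilotDataOfK T.D T.K) (logvAnalytic_analyticLogv (F := T.K)) (M P l T) (archPk P l T) (archSub P l T) (Ψ P l T)
          (act P l T) (Mmod P l T) (region P l T) (n P l T) (lat P l T) (sig P l T) (split P l T) (qData P l T)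
          (exists_realising_qIdeles_pilotDataOfK T.D).choose
          (exists_realising_thetaIdeles_pilotDataOfK T.D).choose
          (exists_realising_qIdeles_pilotDataOfK T.D).choose_spec.1
          (exists_realising_qIdeles_pilotDataOfK T.D).choose_spec.2.1).SlotLicence →
      (¬ (Cor312Vol.PilotKummerCompatHull
        (LatticeSituation.ofShells (logShellsDH (pilotDataOfK T.D T.K) (analyticLogv T.K)) (M P l T) (archPk P l T)
          (archSub P l T) (summandPiecesPr (pilotDataOfK T.D T.K) (logvAnalytic_analyticLogv (F := T.K))).Adm
          (summandPiecesPr (pilotDataOfK T.D T.K) (logvAnalytic_analyticLogv (F := T.K))).logvol (Ψ P l T) (act P l T) (Mmod P l T)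
          (region P l T) (frobAdm P l T) (frobLogvol P l T) (frobΨ P l T) (frobMmod P l T) (unitImage P l T)
          (ballImage P l T) (thetaDiv P l T))
        (settingPrVolSharp (pilotDataOfK T.D T.K) (logvAnalytic_analyticLogv (F := T.K)) (M P l T) (archPk P l T) (archSub P l T) (Ψ P l T)
          (act P l T) (Mmod P l T) (region P l T) (n P l T) (lat P l T) (sig P l T) (split P l T) (qData P l T)
          (exists_realising_qIdeles_pilotDataOfK T.D).choose
          (exists_realising_thetaIdeles_pilotDataOfK T.D).choose
          (exists_realising_qIdeles_pilotDataOfK T.D).choose_spec.1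
          (exists_realising_qIdeles_pilotDataOfK T.D).choose_spec.2.1)
        (fun _ => Cor312.Setting.qRegion
        (settingPrVolSharp (pilotDataOfK T.D T.K) (logvAnalytic_analyticLogv (F := T.K)) (M P l T) (archPk P l T) (archSub P l T) (Ψ P l T)
          (act P l T) (Mmod P l T) (region P l T) (n P l T) (lat P l T) (sig P l T) (split P l T) (qData P l T)
          (exists_realising_qIdeles_pilotDataOfK T.D).choose
          (exists_realising_thetaIdeles_pilotDataOfK T.D).choose
          (exists_realising_qIdeles_pilotDataOfK T.D).choose_spec.1
          (exists_realising_qIdeles_pilotDataOfK T.D).choose_spec.2.1)) (qK P l T)) ∨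
        ¬ (∃ M : Finset ℕ,
        (∀ p : ℕ, p.Prime →
          (¬ ∀ V W : HeightOneSpectrum (𝓞 ↥(IntermediateField.adjoin ℚ ({Cor22.jInv P.x} : Set P.F))),
            V ∈ placesOver _ p → W ∈ placesOver _ p →
            (if ord _ V (Cor22.jMod P) < 0 ∧ ((2 : ℕ) : 𝓞 _) ∉ V.asIdeal ∧ ((l : ℕ) : 𝓞 _) ∉ V.asIdeal
              then ((-ord _ V (Cor22.jMod P) : ℤ) : ℝ) * logNorm _ V / (localDegree _ V : ℝ) else 0) =
            (if ord _ W (Cor22.jMod P) < 0 ∧ ((2 : ℕ) : 𝓞 _) ∉ W.asIdeal ∧ ((l : ℕ) : 𝓞 _) ∉ W.asIdeal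
              then ((-ord _ W (Cor22.jMod P) : ℤ) : ℝ) * logNorm _ W / (localDegree _ W : ℝ) else 0)) → p ∈ M) ∧
        ((l : ℝ) + 1) / 24 *
            ∑ p ∈ M, ∑ V : placesOver ↥(IntermediateField.adjoin ℚ ({Cor22.jInv P.x} : Set P.F)) p,
              (if ord _ V.1 (Cor22.jMod P) < 0 ∧ ((2 : ℕ) : 𝓞 _) ∉ V.1.asIdeal ∧ ((l : ℕ) : 𝓞 _) ∉ V.1.asIdeal then
                weight _ V.1 * (((-ord _ V.1 (Cor22.jMod P) : ℤ) : ℝ) * logNorm _ V.1 / (localDegree _ V.1 : ℝ))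
               else 0) ≤
          ((l : ℝ) + 1) / 4 * (4 * ((Cor22.dmod P : ℝ) - 1) / l * (P.logDiff + Cor22.logCondAvoid P {2, l})
            + 20 / 3 * Real.log (((2 ^ 12 * 3 ^ 3 * 5 * Cor22.dmod P : ℕ) : ℝ) * l)
              * max 0 (((Nat.primeCounting (2 ^ 12 * 3 ^ 3 * 5 * Cor22.dmod P * l) : ℝ)
                - (2 * (Cor22.dmod P : ℝ) * (P.logDiff + Cor22.logCondAvoid P {2, l}) + Real.log (2 * 3 * 5 * (l : ℝ)))
                  / Real.log 2))))) →
      T.Cor312PerImageOf)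
    : _root_.ABC := by
  refine ABC_of_squeezeIII_content fun P hP l hl h5 hc h2 h5' h6 hct => ?_
  obtain ⟨T⟩ := ThetaPartII.stub_thetaData P hP l hl h5 hc h2 h5' h6
  have h7 : 7 ≤ l := ThetaPartII.seven_le_of_condP6 hP hl h5 h6
  -- per datum, the PER-IMAGE Corollary where the slot licence holds (READ-P = abc-iut-s2-p7 p462377)
  have hslot : ∀ T' : Cor22.ThetaVolumeDatumAt P l,
      (letI := T'.instFieldF; letI := T'.instNumberFieldF; letI := T'.instAlgebraF; letI := T'.instFieldK
       letI := T'.instNumberFieldK; letI := T'.instAlgebraK; letI := T'.instFieldFbar; letI := T'.instAlgebraFbar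
       letI := T'.instAlgebraKFbar; letI := T'.instIsElliptic
       (settingPrVolSharp (pilotDataOfK T'.D T'.K) (logvAnalytic_analyticLogv (F := T'.K)) (M P l T') (archPk P l T') (archSub P l T') (Ψ P l T')
          (act P l T') (Mmod P l T') (region P l T') (n P l T') (lat P l T') (sig P l T') (split P l T') (qData P l T')
          (exists_realising_qIdeles_pilotDataOfK T'.D).choose
          (exists_realising_thetaIdeles_pilotDataOfK T'.D).choose
          (exists_realising_qIdeles_pilotDataOfK T'.D).choose_spec.1
          (exists_realising_qIdeles_pilotDataOfK T'.D).choose_spec.2.1).SlotLicence) → T'.Cor312PerImageOf := by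
    intro T' hlic
    letI := T'.instFieldF; letI := T'.instNumberFieldF; letI := T'.instAlgebraF; letI := T'.instFieldK
    letI := T'.instNumberFieldK; letI := T'.instAlgebraK; letI := T'.instFieldFbar; letI := T'.instAlgebraFbar
    letI := T'.instAlgebraKFbar; letI := T'.instIsElliptic
    exact GenuineKSlot.cor312PerImageOf_of_slotLicence M archPk archSub Ψ act Mmod region n lat sig split qData T' hlic
      (negLogThetaSlot_settingPrVolSharp_pilotDataOfK_chosen_le_datum T' (M P l T') (archPk P l T') (archSub P l T') (Ψ P l T')
          (act P l T') (Mmod P l T') (region P l T') (n P l T') (lat P l T') (sig P l T') (split P l T') (qData P l T'))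
  have key : ((6 * ((1 + 20 * (Cor22.dmod P : ℝ) / l) * (P.logDiff + Cor22.logCondAvoid P {2, l}))
          + 120 * (2 ^ 12 * 3 ^ 3 * 5 * (Cor22.dmod P : ℝ) * l) < Cor22.logQAvoid P {2, l})) →
      (((l : ℝ) + 1) / 24 - 1 / (2 * l)) * Cor22.logQAvoid P {2, l} ≤
        ((l : ℝ) + 1) / 4 *
          ((1 + 12 * (Cor22.dmod P : ℝ) / l) * (P.logDiff + Cor22.logCondAvoid P {2, l})
            + 2 * Real.log l + 52
            + 20 / 3 * Real.log (((2 ^ 12 * 3 ^ 3 * 5 * Cor22.dmod P : ℕ) : ℝ) * (l : ℝ))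
              * (Nat.primeCounting (2 ^ 12 * 3 ^ 3 * 5 * Cor22.dmod P * l) : ℝ))
        + ThetaVolumeInput.archLogTheta l := by
    intro hbad
    by_cases hOff : (∃ M : Finset ℕ,
        (∀ p : ℕ, p.Prime →
          (¬ ∀ V W : HeightOneSpectrum (𝓞 ↥(IntermediateField.adjoin ℚ ({Cor22.jInv P.x} : Set P.F))),
            V ∈ placesOver _ p → W ∈ placesOver _ p →
            (if ord _ V (Cor22.jMod P) < 0 ∧ ((2 : ℕ) : 𝓞 _) ∉ V.asIdeal ∧ ((l : ℕ) : 𝓞 _) ∉ V.asIdeal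
              then ((-ord _ V (Cor22.jMod P) : ℤ) : ℝ) * logNorm _ V / (localDegree _ V : ℝ) else 0) =
            (if ord _ W (Cor22.jMod P) < 0 ∧ ((2 : ℕ) : 𝓞 _) ∉ W.asIdeal ∧ ((l : ℕ) : 𝓞 _) ∉ W.asIdeal
              then ((-ord _ W (Cor22.jMod P) : ℤ) : ℝ) * logNorm _ W / (localDegree _ W : ℝ) else 0)) → p ∈ M) ∧
        ((l : ℝ) + 1) / 24 *
            ∑ p ∈ M, ∑ V : placesOver ↥(IntermediateField.adjoin ℚ ({Cor22.jInv P.x} : Set P.F)) p,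
              (if ord _ V.1 (Cor22.jMod P) < 0 ∧ ((2 : ℕ) : 𝓞 _) ∉ V.1.asIdeal ∧ ((l : ℕ) : 𝓞 _) ∉ V.1.asIdeal then
                weight _ V.1 * (((-ord _ V.1 (Cor22.jMod P) : ℤ) : ℝ) * logNorm _ V.1 / (localDegree _ V.1 : ℝ))
               else 0) ≤
          ((l : ℝ) + 1) / 4 * (4 * ((Cor22.dmod P : ℝ) - 1) / l * (P.logDiff + Cor22.logCondAvoid P {2, l})
            + 20 / 3 * Real.log (((2 ^ 12 * 3 ^ 3 * 5 * Cor22.dmod P : ℕ) : ℝ) * l)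
              * max 0 (((Nat.primeCounting (2 ^ 12 * 3 ^ 3 * 5 * Cor22.dmod P * l) : ℝ)
                - (2 * (Cor22.dmod P : ℝ) * (P.logDiff + Cor22.logCondAvoid P {2, l}) + Real.log (2 * 3 * 5 * (l : ℝ)))
                  / Real.log 2))))
    · -- OFF the mixing locus: the (U) squeeze — `Cor22.Cor312AtDatum` per datum, hull estimate by abc-iut-s2-p1 p455026
      have h312 : Cor22.Cor312AtDatum P l := by
        intro T'
        letI := T'.instFieldF; letI := T'.instNumberFieldF; letI := T'.instAlgebraF; letI := T'.instFieldK
        letI := T'.instNumberFieldK; letI := T'.instAlgebraK; letI := T'.instFieldFbar; letI := T'.instAlgebraFbar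
        letI := T'.instAlgebraKFbar; letI := T'.instIsElliptic
        by_cases hsl : (settingPrVolSharp (pilotDataOfK T'.D T'.K) (logvAnalytic_analyticLogv (F := T'.K)) (M P l T') (archPk P l T') (archSub P l T') (Ψ P l T')
          (act P l T') (Mmod P l T') (region P l T') (n P l T') (lat P l T') (sig P l T') (split P l T') (qData P l T')
          (exists_realising_qIdeles_pilotDataOfK T'.D).choose
          (exists_realising_thetaIdeles_pilotDataOfK T'.D).choose
          (exists_realising_qIdeles_pilotDataOfK T'.D).choose_spec.1
          (exists_realising_qIdeles_pilotDataOfK T'.D).choose_spec.2.1).SlotLicence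
        · exact DHData.cor312Of_of_cor312PerImageOf T'.I (hslot T' hsl)
        by_cases hS : (Cor312Vol.PilotKummerCompatHull
              (LatticeSituation.ofShells (logShellsDH (pilotDataOfK T'.D T'.K) (analyticLogv T'.K)) (M P l T') (archPk P l T')
                (archSub P l T') (summandPiecesPr (pilotDataOfK T'.D T'.K) (logvAnalytic_analyticLogv (F := T'.K))).Adm
                (summandPiecesPr (pilotDataOfK T'.D T'.K) (logvAnalytic_analyticLogv (F := T'.K))).logvol (Ψ P l T') (act P l T') (Mmod P l T')
                (region P l T') (frobAdm P l T') (frobLogvol P l T') (frobΨ P l T') (frobMmod P l T') (unitImage P l T')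
                (ballImage P l T') (thetaDiv P l T'))
              (settingPrVolSharp (pilotDataOfK T'.D T'.K) (logvAnalytic_analyticLogv (F := T'.K)) (M P l T') (archPk P l T') (archSub P l T') (Ψ P l T')
                (act P l T') (Mmod P l T') (region P l T') (n P l T') (lat P l T') (sig P l T') (split P l T') (qData P l T')
                (exists_realising_qIdeles_pilotDataOfK T'.D).choose
                (exists_realising_thetaIdeles_pilotDataOfK T'.D).choose
                (exists_realising_qIdeles_pilotDataOfK T'.D).choose_spec.1
                (exists_realising_qIdeles_pilotDataOfK T'.D).choose_spec.2.1)
              (fun _ => Cor312.Setting.qRegion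
              (settingPrVolSharp (pilotDataOfK T'.D T'.K) (logvAnalytic_analyticLogv (F := T'.K)) (M P l T') (archPk P l T') (archSub P l T') (Ψ P l T')
                (act P l T') (Mmod P l T') (region P l T') (n P l T') (lat P l T') (sig P l T') (split P l T') (qData P l T')
                (exists_realising_qIdeles_pilotDataOfK T'.D).choose
                (exists_realising_thetaIdeles_pilotDataOfK T'.D).choose
                (exists_realising_qIdeles_pilotDataOfK T'.D).choose_spec.1
                (exists_realising_qIdeles_pilotDataOfK T'.D).choose_spec.2.1)) (qK P l T'))
        · exact GenuineK.cor312Of_of_SH T'.D T'.K (M P l T') (archPk P l T') (archSub P l T') (Ψ P l T') (act P l T') (Mmod P l T')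
            (region P l T') (frobAdm P l T') (frobLogvol P l T') (frobΨ P l T') (frobMmod P l T') (unitImage P l T') (ballImage P l T')
            (thetaDiv P l T') (n P l T') (lat P l T') (sig P l T') (split P l T') (qData P l T')
            (exists_realising_thetaIdeles_pilotDataOfK T'.D).choose (exists_realising_qIdeles_pilotDataOfK T'.D).choose
            (fun _ => Cor312.Setting.qRegion
                (settingPrVolSharp (pilotDataOfK T'.D T'.K) (logvAnalytic_analyticLogv (F := T'.K)) (M P l T') (archPk P l T') (archSub P l T') (Ψ P l T')
                (act P l T') (Mmod P l T') (region P l T') (n P l T') (lat P l T') (sig P l T') (split P l T') (qData P l T')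
                (exists_realising_qIdeles_pilotDataOfK T'.D).choose
                (exists_realising_thetaIdeles_pilotDataOfK T'.D).choose
                (exists_realising_qIdeles_pilotDataOfK T'.D).choose_spec.1
                (exists_realising_qIdeles_pilotDataOfK T'.D).choose_spec.2.1)) (qK P l T')
            T'.isVolumeInputOf (exists_realising_qIdeles_pilotDataOfK T'.D).choose_spec.1
            (exists_realising_qIdeles_pilotDataOfK T'.D).choose_spec.2.1 (exists_realising_thetaIdeles_pilotDataOfK T'.D).choose_spec.1
            (exists_realising_thetaIdeles_pilotDataOfK T'.D).choose_spec.2.1 (exists_realising_qIdeles_pilotDataOfK T'.D).choose_spec.2.2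
            hS (fun _ _ => rfl)
            (negLogTheta_settingPrVolSharp_pilotDataOfK_le_datum T' (M P l T') (archPk P l T') (archSub P l T') (Ψ P l T') (act P l T')
              (Mmod P l T') (region P l T') (n P l T') (lat P l T') (sig P l T') (split P l T') (qData P l T')
              (exists_realising_qIdeles_pilotDataOfK T'.D).choose (exists_realising_thetaIdeles_pilotDataOfK T'.D).choose
              (exists_realising_qIdeles_pilotDataOfK T'.D).choose_spec.1 (exists_realising_qIdeles_pilotDataOfK T'.D).choose_spec.2.1
              (exists_realising_thetaIdeles_pilotDataOfK T'.D).choose_spec.1 (exists_realising_thetaIdeles_pilotDataOfK T'.D).choose_spec.2.2)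
        · exact DHData.cor312Of_of_cor312PerImageOf T'.I (hNumJointC P hP l hl h5 hc h2 h5' h6 hbad T' hsl (Or.inl hS))
      exact PointDict.logQAvoid_le_of_cor312AtDatum h312 (hvol_offMixingLocus_holds P hP l hl h5 hc h2 h5' h6 hOff) T hP.1
    · -- ON the mixing locus: the PER-IMAGE squeeze at the datum `T` (pinned per-image `B_III` estimate, abc-iut-c312-d1 p448494)
      refine PointDict.gap_le_BIII_of_cor312PerImageAtDatum hP h7 (fun T' => ?_) T
      letI := T'.instFieldF; letI := T'.instNumberFieldF; letI := T'.instAlgebraF; letI := T'.instFieldK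
      letI := T'.instNumberFieldK; letI := T'.instAlgebraK; letI := T'.instFieldFbar; letI := T'.instAlgebraFbar
      letI := T'.instAlgebraKFbar; letI := T'.instIsElliptic
      by_cases hsl : (settingPrVolSharp (pilotDataOfK T'.D T'.K) (logvAnalytic_analyticLogv (F := T'.K)) (M P l T') (archPk P l T') (archSub P l T') (Ψ P l T')
          (act P l T') (Mmod P l T') (region P l T') (n P l T') (lat P l T') (sig P l T') (split P l T') (qData P l T')
          (exists_realising_qIdeles_pilotDataOfK T'.D).choose
          (exists_realising_thetaIdeles_pilotDataOfK T'.D).choose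
          (exists_realising_qIdeles_pilotDataOfK T'.D).choose_spec.1
          (exists_realising_qIdeles_pilotDataOfK T'.D).choose_spec.2.1).SlotLicence
      · exact hslot T' hsl
      · exact hNumJointC P hP l hl h5 hc h2 h5' h6 hbad T' hsl (Or.inr hOff)
  exact key hct

end Summit.ABC.IUTFork.Conditional

end
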